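import Summits.KontsevichZagierPeriods.KontsevichZagierPeriods.Theorems.KzOnePeriodsE1DerivEta
import Summits.KontsevichZagierPeriods.KontsevichZagierPeriods.Theorems.KzOnePeriodsE1CMCurves
import Literature.NumberTheory.Transcendental.CurvePeriodsEllipticCMIsogenyProofs

/-!
# E1 derivations, part 7: unit complex multiplications (`αΛ = Λ`) and the PIN relations

Sub-problem `KzOnePeriods` (Kontsevich–Zagier period conjecture for 1-periods, the theorem of
Huber–Wüstholz [cite: HuberWustholz2022, Thm 13.3 (2) p.121]); helper lane of the `E1` derivation
modules (`KzOnePeriodsE1DerivSpan`, …, `KzOnePeriodsE1DerivEta`).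

Parts 1–6 derive the rows of the `kz1p` certificates whose abelian logarithms are REAL (rational
points, the real period).  For a curve with complex multiplication by a UNIT `α` of the period
lattice (`αΛ = Λ`; for `y² = 4x³ − g₂x`, `g₃ = 0`, `j = 1728`, the unit is `α = i`,
`KzOnePeriodsE1CMCurves`), the certificates also contain symbols at the image points `[α]P`
(abelian logarithm `α u_P`) and the image period `αΩ₁`, with coefficients in `ℚ(α)`.  This file
supplies the curve-level input for those rows:

* § 1 `CMReps L α {0}` for a unit (`CurvePeriodsEllipticCMIsogenyProofs`), the unit `i` when
  `g₃ = 0`, and the homogeneity formulas `℘(αz) = α⁻²℘(z)`, `℘′(αz) = α⁻³℘′(z)`,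
  `ζ(αz) = α⁻¹ζ(z)`, `φ(αu)`, `ζ(z + αℓ) = ζ(z) + α⁻¹E` on the SAME lattice;
* § 2 the scaled lift `α·D` of a lift `D` and the PIN relations of (R3) (CM isogeny relation,
  [cite: HuberWustholz2022, §13.1 (B) p.120; §18.1 pp.160–161]) for ARBITRARY lifts at an
  arbitrary algebraic base point: `S₀[D′] − α S₀[D] ∈ span`, `Sω[D′] − α Sω[D] ∈ span` and
  `S₁[D′] − α⁻¹ S₁[D] ≡ algebraic · 𝟙`, where `D : t₀ ↝ t₀ + m`, `D′ : t₀ ↝ t₀ + αm`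
  (generic auxiliary base point + translation, as in part 1).

No new axioms; no statements of the programme are cited.
-/

noncomputable section

open MvPolynomial Set Complex
open Literature.NumberTheory.Transcendental Literature.NumberTheory.Transcendental.CurvePeriods
open Literature.NumberTheory.Transcendental.CurvePeriods.Ell
open scoped PeriodPair

namespace Summit.KontsevichZagierPeriods.KzOnePeriods.E1LiftDerivation

/-- `c` lies in the `ℚ̄`-span of the elementary relations (R1)–(R5). -/
local notation3 "InSpanRel " c:arg => ∃ (k : ℕ) (ρ : Fin k → (PeriodSymbol →₀ ℂ))
  (a : Fin k → ℂ), (∀ l, IsElementaryRelation (ρ l)) ∧ (∀ l, IsAlgebraic ℚ (a l)) ∧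
    c = ∑ l, a l • ρ l

variable {L : PeriodPair} (h₂ : IsAlgebraic ℚ L.g₂) (h₃ : IsAlgebraic ℚ L.g₃)

local notation3 "S₀[" D "]" => LiftData.sym h₂ h₃ D (theta0 L) (hasAlgCoeffs_theta0 L h₂ h₃)
local notation3 "S₁[" D "]" => LiftData.sym h₂ h₃ D (theta1 L) (hasAlgCoeffs_theta1 L h₂ h₃)
local notation3 (prettyPrint := false) "Sω[" D "]" =>
  LiftData.sym h₂ h₃ D ((1 / 2 : ℂ) • theta0 L) (hasAlgCoeffs_half_theta0 h₂ h₃)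
local notation3 "𝟙" => (Finsupp.single PeriodSymbol.unit (1 : ℂ) : PeriodSymbol →₀ ℂ)

/-! ## 1. Units of the period lattice -/

section Unit

variable {α : ℂ}

/-- A unit `α` of `Λ` (`αx ∈ Λ ↔ x ∈ Λ`) is a complex multiplication with the single coset
representative `0` of `α⁻¹Λ/Λ = 0`. [cite: Cox2013, §10.B Thm. 10.14] -/
theorem cmReps_of_unit (hα : α ≠ 0) (hU : ∀ x, α * x ∈ L.lattice ↔ x ∈ L.lattice)
    : CMReps L α {0} where
  ne_zero := hα
  mul_mem l hl := (hU l).2 hl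
  zero_mem := Finset.mem_singleton_self 0
  reps x := by simpa using hU x
  distinct c hc c' hc' _ := by
    rw [Finset.mem_singleton] at hc hc'
    rw [hc, hc']

/-- For `g₃ = 0` (`j = 1728`) the period lattice has the unit `i`.
[cite: Cox2013, §10.B Thm. 10.14] -/
theorem unit_I_of_g₃_eq_zero (h : L.g₃ = 0) : ∀ x, I * x ∈ L.lattice ↔ x ∈ L.lattice :=
  I_mul_mem_lattice_iff_of_j_eq_1728 L (j_eq_1728_of_g₃_eq_zero L h)

/-- A unit is an algebraic number. [cite: Cox2013, §10.B Thm. 10.14 (proof)] -/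
theorem isAlgebraic_unit (hα : α ≠ 0) (hU : ∀ x, α * x ∈ L.lattice ↔ x ∈ L.lattice)
    : IsAlgebraic ℚ α := (cmReps_of_unit hα hU).isAlgebraic

/-- `℘(αz) = α⁻² ℘(z)` for a unit `α`. [folklore] -/
theorem weierstrassP_unit_mul (hα : α ≠ 0) (hU : ∀ x, α * x ∈ L.lattice ↔ x ∈ L.lattice) (z : ℂ) :
    ℘[L] (α * z) = (α ^ 2)⁻¹ * ℘[L] z := by
  have h := PeriodPair.weierstrassP_mulLeft α hα L z
  rwa [PeriodPair.weierstrassP_eq_of_lattice_eq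
    (PeriodPair.mulLeft_lattice_eq_of_mul_mem_lattice_iff hα hU)] at h

/-- `℘′(αz) = α⁻³ ℘′(z)` for a unit `α`. [folklore] -/
theorem derivWeierstrassP_unit_mul (hα : α ≠ 0) (hU : ∀ x, α * x ∈ L.lattice ↔ x ∈ L.lattice)
    (z : ℂ) :
    ℘'[L] (α * z) = (α ^ 3)⁻¹ * ℘'[L] z := by
  have h := PeriodPair.derivWeierstrassP_mulLeft α hα L z
  rwa [PeriodPair.derivWeierstrassP_eq_of_lattice_eq
    (PeriodPair.mulLeft_lattice_eq_of_mul_mem_lattice_iff hα hU)] at h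

/-- `φ(αu) = (α⁻²x, α⁻³y)` if `φ(u) = (x, y)`. [folklore] -/
theorem phi_unit_mul (hα : α ≠ 0) (hU : ∀ x, α * x ∈ L.lattice ↔ x ∈ L.lattice) {u x y : ℂ}
    (h : phi L u = ![x, y]) :
    phi L (α * u) = ![(α ^ 2)⁻¹ * x, (α ^ 3)⁻¹ * y] := by
  have e1 : ℘[L] u = x := by simpa using congrFun h 0
  have e2 : ℘'[L] u / 2 = y := by simpa using congrFun h 1
  simp only [phi, weierstrassP_unit_mul hα hU, derivWeierstrassP_unit_mul hα hU, e1, ← e2,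
    mul_div_assoc]

/-- The quasi-period of the image period: if `ζ(z + ℓ) = ζ(z) + E` for all `z`, then
`ζ(z + αℓ) = ζ(z) + α⁻¹E` for all `z`. [folklore] -/
theorem zeta_add_unit_period (hα : α ≠ 0) (hU : ∀ x, α * x ∈ L.lattice ↔ x ∈ L.lattice) {ℓ E : ℂ}
    (hE : ∀ z, L.weierstrassZeta (z + ℓ) = L.weierstrassZeta z + E)
    (z : ℂ) : L.weierstrassZeta (z + α * ℓ) = L.weierstrassZeta z + α⁻¹ * E := by
  have e1 : z + α * ℓ = α * (α⁻¹ * z + ℓ) := by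
    rw [mul_add, ← mul_assoc, mul_inv_cancel₀ hα, one_mul]
  have e2 : z = α * (α⁻¹ * z) := by rw [← mul_assoc, mul_inv_cancel₀ hα, one_mul]
  rw [e1, weierstrassZeta_mul_of_mul_mem_lattice_iff L hα hU, hE, mul_add,
    ← weierstrassZeta_mul_of_mul_mem_lattice_iff L hα hU, ← e2]

/-- `αz ∉ Λ ↔ z ∉ Λ`. -/
theorem unit_mul_notMem_iff (hU : ∀ x, α * x ∈ L.lattice ↔ x ∈ L.lattice) {z : ℂ} :
    α * z ∉ L.lattice ↔ z ∉ L.lattice := not_congr (hU z)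

include h₂ h₃ in
/-- `[α]` maps algebraic points to algebraic points. [cite: Cox2013, §10.B Thm. 10.14] -/
theorem isAlgPt_unit_mul (hα : α ≠ 0) (hU : ∀ x, α * x ∈ L.lattice ↔ x ∈ L.lattice) {z : ℂ}
    (hz : IsAlgPt L z) : IsAlgPt L (α * z) :=
  (cmReps_of_unit hα hU).isAlgPt_mul h₂ h₃ hz ((unit_mul_notMem_iff hU).2 hz.1)

include h₂ h₃ in
/-- `α` times an algebraic logarithm is an algebraic logarithm. -/
theorem algLog_unit_mul (hα : α ≠ 0) (hU : ∀ x, α * x ∈ L.lattice ↔ x ∈ L.lattice) {m : ℂ}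
    (hm : AlgLog L m) : AlgLog L (α * m) := by
  rcases hm with hm | hm
  · exact algLog_of_mem ((hU m).2 hm)
  · exact (isAlgPt_unit_mul h₂ h₃ hα hU hm).algLog

end Unit

/-! ### The unit `i` -/

/-- Elements of `ℚ(i)` are algebraic: the form in which the generated files state coefficients. -/
theorem isAlgebraic_of_eq_gauss {z : ℂ} (p q : ℚ) (h : z = (p : ℂ) + (q : ℂ) * I) :
    IsAlgebraic ℚ z := by
  rw [h]
  exact (isAlgebraic_algebraMap p).add ((isAlgebraic_algebraMap q).mul G0Derivation.isAlgebraic_I)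

section UnitI

/-- `φ(iu) = (−x, iy)` if `φ(u) = (x, y)`. [cite: Cox2013, §10.B; SilvermanAEC2009, III.10] -/
theorem phi_I_mul (hU : ∀ x, I * x ∈ L.lattice ↔ x ∈ L.lattice) {u x y : ℂ}
    (h : phi L u = ![x, y]) : phi L (I * u) = ![-x, I * y] := by
  rw [phi_unit_mul I_ne_zero hU h]
  simp

/-- `ζ(iu) = −i ζ(u)`. [folklore] -/
theorem weierstrassZeta_I_mul (hU : ∀ x, I * x ∈ L.lattice ↔ x ∈ L.lattice) (z : ℂ) :
    L.weierstrassZeta (I * z) = -I * L.weierstrassZeta z := by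
  rw [weierstrassZeta_mul_of_mul_mem_lattice_iff L I_ne_zero hU, inv_I]

/-- `ζ(z + iℓ) = ζ(z) − iE` if `ζ(z + ℓ) = ζ(z) + E`. [folklore] -/
theorem zeta_add_I_period (hU : ∀ x, I * x ∈ L.lattice ↔ x ∈ L.lattice) {ℓ E : ℂ}
    (hE : ∀ z, L.weierstrassZeta (z + ℓ) = L.weierstrassZeta z + E)
    (z : ℂ) : L.weierstrassZeta (z + I * ℓ) = L.weierstrassZeta z + -I * E := by
  rw [zeta_add_unit_period I_ne_zero hU hE, inv_I]

end UnitI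

/-! ## 2. The PIN relations -/

section PIN

variable {α : ℂ}

include h₂ h₃ in
/-- A generic auxiliary base point for the PIN relations: `s` with lifts `s ↝ s + m` and such that
the translations by `t₀ − s` (to base `t₀`) and by `t₀ − αs` (from base `αs` to base `t₀`) are
admissible for `span_translate_theta0/theta1`. [folklore] -/
theorem exists_pin_base (hα : α ≠ 0) (hU : ∀ x, α * x ∈ L.lattice ↔ x ∈ L.lattice) {m t₀ : ℂ}
    (hm : AlgLog L m) (ht₀ : IsAlgPt L t₀)
    (htm : t₀ + m ∉ L.lattice) (htαm : t₀ + α * m ∉ L.lattice) :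
    ∃ s : ℂ, IsAlgPt L s ∧ IsAlgPt L (s + m) ∧ IsAlgPt L (t₀ - s) ∧ IsAlgPt L (t₀ - α * s) ∧
      ℘[L] s ≠ ℘[L] (t₀ - s) ∧ ℘[L] (s + m) ≠ ℘[L] (t₀ - s) ∧
      ℘[L] (α * s) ≠ ℘[L] (t₀ - α * s) ∧ ℘[L] (α * s + α * m) ≠ ℘[L] (t₀ - α * s) := by
  classical
  obtain ⟨s, hs, hB, hC⟩ := exists_generic_algPt₂ h₂ h₃ ({-m, t₀, α⁻¹ * t₀} : Finset ℂ)
    ({t₀, t₀ - m, α⁻¹ * t₀, α⁻¹ * t₀ - m} : Finset ℂ)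
  have hsm : s + m ∉ L.lattice := by simpa [sub_neg_eq_add] using hB (-m) (by simp)
  have hsm' : IsAlgPt L (s + m) := (hs.algLog.add L h₂ hm).isAlgPt hsm
  have hαs : IsAlgPt L (α * s) := isAlgPt_unit_mul h₂ h₃ hα hU hs
  have hαsm : α * s + α * m ∉ L.lattice := by
    rw [← mul_add]; exact (isAlgPt_unit_mul h₂ h₃ hα hU hsm').1
  -- membership transported through the unit
  have key : ∀ {x y : ℂ}, α * x = y → y ∈ L.lattice → x ∈ L.lattice := fun e h =>
    (hU _).1 (e ▸ h)
  have hv : t₀ - s ∉ L.lattice := fun h => hB t₀ (by simp) (by simpa using neg_mem h)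
  have hαα : α * α⁻¹ = 1 := mul_inv_cancel₀ hα
  have hv' : t₀ - α * s ∉ L.lattice := fun h => hB (α⁻¹ * t₀) (by simp)
    (key (by linear_combination (-t₀) * hαα) (neg_mem h))
  refine ⟨s, hs, hsm', (ht₀.algLog.sub L h₂ hs.algLog).isAlgPt hv,
    (ht₀.algLog.sub L h₂ hαs.algLog).isAlgPt hv', ?_, ?_, ?_, ?_⟩
  · rw [weierstrassP_ne_iff L hs.1 hv]
    refine ⟨by rw [add_sub_cancel]; exact ht₀.1, ?_⟩
    convert hC t₀ (by simp) using 2; ring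
  · rw [weierstrassP_ne_iff L hsm hv]
    refine ⟨by convert htm using 2; ring, ?_⟩
    convert hC (t₀ - m) (by simp) using 2; ring
  · rw [weierstrassP_ne_iff L hαs.1 hv']
    exact ⟨by rw [add_sub_cancel]; exact ht₀.1,
      fun h => hC (α⁻¹ * t₀) (by simp) (key (by linear_combination (-t₀) * hαα) h)⟩
  · rw [weierstrassP_ne_iff L hαsm hv']
    exact ⟨by convert htαm using 2; ring,
      fun h => hC (α⁻¹ * t₀ - m) (by simp) (key (by linear_combination (-t₀) * hαα) h)⟩

include h₂ h₃ in
/-- **PIN relation, `θ₀ = dx/y`**: for lifts `D : t₀ ↝ t₀ + m` and `D′ : t₀ ↝ t₀ + αm` of an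
algebraic logarithm `m` and its image `αm` under a unit `α`, `S₀[D′] − α S₀[D]` lies in the span of
the elementary relations: the CM isogeny relation `∫_{α·γ} θ₀ = α ∫_γ θ₀` (R3) at a generic base
point [cite: HuberWustholz2022, §13.1 (B) p.120; §18.1 pp.160–161], transported by translation
invariance. -/
theorem span_unit_theta0 (hα : α ≠ 0) (hU : ∀ x, α * x ∈ L.lattice ↔ x ∈ L.lattice) {m t₀ : ℂ}
    (hm : AlgLog L m) (ht₀ : IsAlgPt L t₀)
    (D : LiftData L t₀ (t₀ + m)) (D' : LiftData L t₀ (t₀ + α * m)) :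
    InSpanRel (S₀[D'] - α • S₀[D]) := by
  have hR := cmReps_of_unit hα hU
  obtain ⟨s, hs, hsm, hv, hv', ha, hb, ha', hb'⟩ :=
    exists_pin_base h₂ h₃ hα hU hm ht₀ D.alg_stop.1 D'.alg_stop.1
  obtain ⟨Ds⟩ := LiftData.nonempty hs hsm
  -- the image lift `α·Ds : αs ↝ α(s + m)`
  let Dα : LiftData L (α * s) (α * (s + m)) :=
    { g := fun t => α * Ds.g t
      contDiff := contDiff_const.mul Ds.contDiff
      avoid := fun t ht h => Ds.avoid t ht ((hU _).1 h)
      start := by rw [Ds.start]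
      stop := by rw [Ds.stop]
      alg_start := isAlgPt_unit_mul h₂ h₃ hα hU Ds.alg_start
      alg_stop := isAlgPt_unit_mul h₂ h₃ hα hU Ds.alg_stop }
  -- the CM isogeny relation at `s`
  have hcm : InSpanRel (S₀[Dα] - α • S₀[Ds]) :=
    hR.span_cmul_theta0 h₂ h₃ Ds.contDiff Dα.avoid Ds.avoid Ds.alg0 Ds.alg1 Dα.contDiff
      Dα.alg0 Dα.alg1
  -- translation from base `s` to base `t₀`
  have e0 : s + (t₀ - s) = t₀ := by ring
  have e1 : s + m + (t₀ - s) = t₀ + m := by ring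
  have h1 : InSpanRel (S₀[D] - S₀[Ds]) := by
    have key := LiftData.span_translate_theta0 h₂ h₃ hv Ds (D.cast e0.symm e1.symm) ha hb
    rwa [LiftData.sym_cast] at key
  -- translation from base `αs` to base `t₀`
  have e0' : α * s + (t₀ - α * s) = t₀ := by ring
  have e1' : α * (s + m) + (t₀ - α * s) = t₀ + α * m := by ring
  have hb'' : ℘[L] (α * (s + m)) ≠ ℘[L] (t₀ - α * s) := by rwa [mul_add]
  have h2 : InSpanRel (S₀[D'] - S₀[Dα]) := by
    have key := LiftData.span_translate_theta0 h₂ h₃ hv' Dα (D'.cast e0'.symm e1'.symm) ha' hb''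
    rwa [LiftData.sym_cast] at key
  have h := CurvePeriods.span_sub (CurvePeriods.span_add h2 hcm)
    (CurvePeriods.span_smul hR.isAlgebraic h1)
  have e : S₀[D'] - α • S₀[D] = S₀[D'] - S₀[Dα] + (S₀[Dα] - α • S₀[Ds]) - α • (S₀[D] - S₀[Ds]) := by
    rw [smul_sub]; abel
  rw [e]; exact h

include h₂ h₃ in
/-- **PIN relation, `ω = dx/(2y)`**: `Sω[D′] − α Sω[D] ∈ span`.
[cite: HuberWustholz2022, §13.1 (B) p.120; §18.1 pp.160–161] -/
theorem span_unit_omega (hα : α ≠ 0) (hU : ∀ x, α * x ∈ L.lattice ↔ x ∈ L.lattice) {m t₀ : ℂ}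
    (hm : AlgLog L m) (ht₀ : IsAlgPt L t₀)
    (D : LiftData L t₀ (t₀ + m)) (D' : LiftData L t₀ (t₀ + α * m)) :
    InSpanRel (Sω[D'] - α • Sω[D]) := by
  have hhalf : IsAlgebraic ℚ (1 / 2 : ℂ) := by
    simpa using (isAlgebraic_algebraMap (R := ℚ) (A := ℂ) (1 / 2 : ℚ))
  have h := CurvePeriods.span_add
    (CurvePeriods.span_sub (span_sym_omega_sub h₂ h₃ D')
      (CurvePeriods.span_smul (isAlgebraic_unit hα hU) (span_sym_omega_sub h₂ h₃ D)))
    (CurvePeriods.span_smul hhalf (span_unit_theta0 h₂ h₃ hα hU hm ht₀ D D'))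
  have e : Sω[D'] - α • Sω[D] = Sω[D'] - (1 / 2 : ℂ) • S₀[D'] - α • (Sω[D] - (1 / 2 : ℂ) • S₀[D]) +
      (1 / 2 : ℂ) • (S₀[D'] - α • S₀[D]) := by
    simp only [smul_sub, smul_smul]; rw [mul_comm α (1 / 2 : ℂ)]; abel
  rw [e]; exact h

include h₂ h₃ in
/-- **PIN relation, `θ₁ = x dx/y`**: `S₁[D′] − α⁻¹ S₁[D] ≡ κ · 𝟙` modulo the span, for an algebraic
constant `κ` (the CM isogeny relation for the second-kind form, `∫_{α·γ} θ₁ = α⁻¹∫_γ θ₁ + algebraic`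
for the single coset representative `0`, [cite: HuberWustholz2022, §13.1 (B) p.120; §18.1
pp.160–161], transported by translation invariance `span_translate_theta1`). -/
theorem span_unit_theta1 (hα : α ≠ 0) (hU : ∀ x, α * x ∈ L.lattice ↔ x ∈ L.lattice) {m t₀ : ℂ}
    (hm : AlgLog L m) (ht₀ : IsAlgPt L t₀)
    (D : LiftData L t₀ (t₀ + m)) (D' : LiftData L t₀ (t₀ + α * m)) :
    ∃ κ : ℂ, IsAlgebraic ℚ κ ∧ InSpanRel (S₁[D'] - α⁻¹ • S₁[D] - κ • 𝟙) := by
  classical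
  have hR := cmReps_of_unit hα hU
  obtain ⟨s, hs, hsm, hv, hv', ha, hb, ha', hb'⟩ :=
    exists_pin_base h₂ h₃ hα hU hm ht₀ D.alg_stop.1 D'.alg_stop.1
  obtain ⟨Ds⟩ := LiftData.nonempty hs hsm
  -- the image lift `α·Ds : αs ↝ α(s + m)`
  let Dα : LiftData L (α * s) (α * (s + m)) :=
    { g := fun t => α * Ds.g t
      contDiff := contDiff_const.mul Ds.contDiff
      avoid := fun t ht h => Ds.avoid t ht ((hU _).1 h)
      start := by rw [Ds.start]
      stop := by rw [Ds.stop]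
      alg_start := isAlgPt_unit_mul h₂ h₃ hα hU Ds.alg_start
      alg_stop := isAlgPt_unit_mul h₂ h₃ hα hU Ds.alg_stop }
  -- the CM isogeny relation at `s`: `bC = α⁻¹`, `aC = 0`, `GC = 0` for `S = {0}`
  have hbC : bC α ({0} : Finset ℂ) = α⁻¹ := by simp [bC]
  have haC : aC L α ({0} : Finset ℂ) = 0 := by simp [aC, KC]
  have hGC : GC L α ({0} : Finset ℂ) = 0 := by simp [GC]
  have hcm : InSpanRel (S₁[Dα] - α⁻¹ • S₁[Ds]) := by
    have key := hR.span_cmul_theta1 h₂ h₃ Ds.contDiff Dα.avoid Ds.avoid Ds.alg0 Ds.alg1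
      Dα.contDiff Dα.alg0 Dα.alg1
    rw [hbC, haC, hGC] at key
    simp only [map_zero, sub_self, zero_smul, sub_zero, add_zero] at key
    exact key
  -- translations
  have e0 : s + (t₀ - s) = t₀ := by ring
  have e1 : s + m + (t₀ - s) = t₀ + m := by ring
  have h1 := LiftData.span_translate_theta1 h₂ h₃ hv Ds (D.cast e0.symm e1.symm) ha hb
  rw [LiftData.sym_cast] at h1
  have e0' : α * s + (t₀ - α * s) = t₀ := by ring
  have e1' : α * (s + m) + (t₀ - α * s) = t₀ + α * m := by ring
  have hb'' : ℘[L] (α * (s + m)) ≠ ℘[L] (t₀ - α * s) := by rwa [mul_add]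
  have h2 := LiftData.span_translate_theta1 h₂ h₃ hv' Dα (D'.cast e0'.symm e1'.symm) ha' hb''
  rw [LiftData.sym_cast] at h2
  set κ₁ := eval (psiT L (t₀ - s) (s + m)) (rPolyT L (t₀ - s)) -
    eval (psiT L (t₀ - s) s) (rPolyT L (t₀ - s))
  set κ₂ := eval (psiT L (t₀ - α * s) (α * (s + m))) (rPolyT L (t₀ - α * s)) -
    eval (psiT L (t₀ - α * s) (α * s)) (rPolyT L (t₀ - α * s))
  have hκ₁ : IsAlgebraic ℚ κ₁ := isAlgebraic_translate_const L hv hs hsm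
  have hκ₂ : IsAlgebraic ℚ κ₂ := isAlgebraic_translate_const L hv' Dα.alg_start Dα.alg_stop
  refine ⟨κ₂ - α⁻¹ * κ₁, hκ₂.sub (hR.isAlgebraic_inv.mul hκ₁), ?_⟩
  have h := CurvePeriods.span_sub (CurvePeriods.span_add h2 hcm)
    (CurvePeriods.span_smul hR.isAlgebraic_inv h1)
  have e : S₁[D'] - α⁻¹ • S₁[D] - (κ₂ - α⁻¹ * κ₁) • 𝟙 = S₁[D'] - S₁[Dα] - κ₂ • 𝟙 +
      (S₁[Dα] - α⁻¹ • S₁[Ds]) - α⁻¹ • (S₁[D] - S₁[Ds] - κ₁ • 𝟙) := by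
    rw [sub_smul, smul_sub, smul_sub, smul_smul]; abel
  rw [e]; exact h

end PIN

end Summit.KontsevichZagierPeriods.KzOnePeriods.E1LiftDerivation

end
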